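import Summits.QuantumFields.BalabanUV.T4Continuum.Support.NE7FreeLandauSegment
import Summits.QuantumFields.BalabanUV.T4Continuum.Support.NE7CubeLandauMinimiserFree
import HarnessLib

/-!
# NE7 — ONE STEP OF THE INCREMENTAL CONSTRUCTION OF A SMALL FREE-BOUNDARY LANDAU GAUGE ON A BOX: if the links `V` on `periodBox (m+1)` are
# `v₀`-close to `1` and their free-boundary Euler–Lagrange defect is `≤ e₀`, then — in the regime `n·w(1 + 2dM) ≤ ½`, `w = e^{πθ}(1+v₀) − 1`, and for
# `e₀`, `θ` small against `θ²∕(n d² m² M^d)` — there is a unitary site gauge `g`, pinned `g(0) = 1`, with `‖g − 1‖ ≤ θ` everywhere, in which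
# `g_x V(x,κ) g_{x+e_κ}ᴴ` satisfies the free-boundary lattice Landau condition at EVERY site of the box (F312c)

Cell `pub-balaban`, rung (B)+1 sub-cell t4, lineage `b2b-balaban-t4-ne7-p1` (CRUX PROVER NE7 #1 = OWNER of row NE7), generation 93; memo
`t4/b2b-balaban-t4-ne7-p1-g93/UHLENBECK-ROAD.md` §4.  Over F312b `NE7FreeLandauSegment` (segment estimates, path bound), F312a
`NE7FreeLandauFirstVariation` (site variations, Euler–Lagrange extraction, Taylor), F310 (derivatives), `MatrixLog.exists_isHermitian_exp_eq`
([Balaban1985Averaging] (23)–(25): unitary `= e^{iA}`, `‖U − 1‖ ≤ ‖A‖ ≤ (π∕2)‖U − 1‖`) and the compactness pattern of F304′.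

THE ARGUMENT (road U-IM = existence half of the one-scale lattice Uhlenbeck lemma by INCREMENTAL MINIMISATION).  Minimise the free-boundary trace
link functional `Σ_b (1 − Re tr(g_xV_bg_{x'}ᴴ)∕n)` over the compact set of unitary site gauges on the box with `g(0) = 1` and `‖g_x − 1‖ ≤ θ`.  If the
minimiser touched the boundary (`‖g_{x₁} − 1‖ = θ`), write `g = e^{η}` sitewise with `‖η‖ ≤ (π∕2)θ`, `‖η_{x₁}‖ ≥ θ`, `η_0 = 0`; along `t ↦ e^{tη}`
the functional has `φ(1) ≤ φ(0)` (minimality against `g = 1`), first derivative `|φ′(0)| ≤ ½M^dρe₀` (F312b) and second derivative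
`≥ ½D(η) − ρ²M^d e₁ ≥ θ²∕(2nd²m²) − ρ²M^d e₁` (F312b + path bound) — contradicting `φ(1) − φ(0) ≥ φ′(0) + ½ min φ″` (Taylor) under the smallness
hypothesis.  So the minimiser is interior; single-site variations `e^{tZ}` at `y ≠ 0` stay admissible, the derivative vanishes (F312a), hence the
free-boundary Landau condition holds at every `y ≠ 0`, and at `y = 0` because the conditions sum to zero over the box.

WHAT ([folklore]; 0 def, 0 sorry): **`freeLandau_step`**.
HONEST FRAMING (page 1): a finite-dimensional variational lemma on a lattice box for ARBITRARY links `V`; nothing of Bałaban's asserted; NE7 NOT PROVED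
here; spine 0∕9; finite T⁴ rung (B)+1 — NOT infinite volume, NOT mass gap, NOT `BetaPertH`, NOT Clay.  No `sorry`; axioms ⊆ {propext, Classical.choice,
Quot.sound}.
-/

set_option autoImplicit false

open scoped BigOperators Matrix Matrix.Norms.L2Operator
open Finset NormedSpace Set

namespace Summit.QuantumFields.BalabanUV.T4Continuum.NE7FreeLandauStep

open Literature.MathematicalPhysics.QuantumFieldTheory.Balaban1983to89
open B7Prop1Explicit UnitaryModel MatrixNorms
open T4AveragingDeficitWallBoundary (periodBox mem_periodBox card_periodBox)
open NE3HilbertSchmidtTorus (HSMat)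
open NE3HilbertSchmidtTorus.HSMat (toHS ofHS ofHS_add ofHS_smul ofHS_toHS)
open NE7LinkFunctionalMinimiser (norm_sq_le_one_of_unitary)
open NE7TraceLinkSecondVariation (hasDerivAt_one_sub_nReTr_expConj hasDerivAt_nReTr_firstVar hasDerivAt_sum_ite)
open NE7TraceLinkHessianLower (norm_sq_le_card_mul_nhsNormSq)
open NE7FreeLandauFirstVariation (sum_EL_eq_zero hasDerivAt_siteVariation EL_of_critical taylor_lower_unit_interval)
open NE7FreeLandauSegment (norm_sub_zero_le_path segment_secondVar_lower segment_firstVar_abs_le)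
open scoped Classical

noncomputable section

variable {d : ℕ} {n : Type*} [Fintype n] [DecidableEq n] [Nonempty n]

set_option maxHeartbeats 3200000 in
/-- **ONE STEP OF THE INCREMENTAL CONSTRUCTION** (`d ≥ 1`, `m ≥ 1`, box `periodBox (m+1) ⊂ ℤᵈ`).  Let `V` be links with `‖V(x,κ) − 1‖ ≤ v₀` on the box
bonds and free-boundary Euler–Lagrange defect `≤ e₀` at every box site; let `θ > 0`, `ρ = (π/2)θ`, `w = e^{2ρ}(1+v₀) − 1`, and assume the regime
`n·w + 2n·d·(m+1)·w ≤ ½` and the smallness `½(m+1)^d·ρ·e₀ + ½ρ²(m+1)^d·(e₀ + 4d(1+v₀)(e^{2ρ} − 1)) < θ²∕(4n·d²·m²)`.  Then there is a unitary site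
gauge `g`, `= 1` off the box, `g(0) = 1`, `‖g − 1‖ ≤ θ` everywhere, such that the links `g_xV(x,κ)g_{x+e_κ}ᴴ` satisfy the free-boundary lattice
Landau condition `Σ_κ [𝟙(y+e_κ ∈ box)(W − Wᴴ)(y,κ) − 𝟙(y−e_κ ∈ box)(W − Wᴴ)(y−e_κ,κ)] = 0` at EVERY site `y` of the box. [folklore] -/
theorem freeLandau_step (hd : 1 ≤ d) {m : ℕ} (hm : 1 ≤ m) (V : Site d → Fin d → Matrix n n ℂ) {v₀ e₀ θ : ℝ}
    (hv₀ : 0 ≤ v₀) (hθ : 0 < θ)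
    (hV1 : ∀ (x : Site d) (κ : Fin d), x ∈ periodBox (d := d) (m + 1) → x + e κ ∈ periodBox (d := d) (m + 1) → ‖V x κ - 1‖ ≤ v₀)
    (hEL : ∀ x ∈ periodBox (d := d) (m + 1), ‖∑ κ : Fin d, ((if x + e κ ∈ periodBox (d := d) (m + 1) then (V x κ - (V x κ)ᴴ) else 0)
      - (if x - e κ ∈ periodBox (d := d) (m + 1) then (V (x - e κ) κ - (V (x - e κ) κ)ᴴ) else 0))‖ ≤ e₀)
    (hreg : (Fintype.card n : ℝ) * (Real.exp (2 * (Real.pi / 2 * θ)) * (1 + v₀) - 1)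
      + 2 * (Fintype.card n : ℝ) * d * (m + 1) * (Real.exp (2 * (Real.pi / 2 * θ)) * (1 + v₀) - 1) ≤ 1 / 2)
    (hsmall : (1 / 2) * (((m + 1 : ℕ) : ℝ) ^ d * ((Real.pi / 2 * θ) * e₀))
      + (1 / 2) * ((Real.pi / 2 * θ) ^ 2 * ((m + 1 : ℕ) : ℝ) ^ d * (e₀ + 4 * d * ((1 + v₀) * (Real.exp (2 * (Real.pi / 2 * θ)) - 1))))
      < θ ^ 2 / (4 * (Fintype.card n : ℝ) * d ^ 2 * m ^ 2)) :
    ∃ g : Site d → Matrix n n ℂ, (∀ x, g x ∈ Matrix.unitaryGroup n ℂ) ∧ (∀ x, x ∉ periodBox (d := d) (m + 1) → g x = 1) ∧ g 0 = 1 ∧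
      (∀ x, ‖g x - 1‖ ≤ θ) ∧
      ∀ y ∈ periodBox (d := d) (m + 1), ∑ κ : Fin d,
        ((if y + e κ ∈ periodBox (d := d) (m + 1) then
            (g y * V y κ * (g (y + e κ))ᴴ - (g y * V y κ * (g (y + e κ))ᴴ)ᴴ) else 0)
          - (if y - e κ ∈ periodBox (d := d) (m + 1) then
            (g (y - e κ) * V (y - e κ) κ * (g (y - e κ + e κ))ᴴ - (g (y - e κ) * V (y - e κ) κ * (g (y - e κ + e κ))ᴴ)ᴴ) else 0)) = 0 := by
  letI : CStarAlgebra (Matrix n n ℂ) := {}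
  letI : NormedAlgebra ℚ (Matrix n n ℂ) := NormedAlgebra.restrictScalars ℚ ℂ (Matrix n n ℂ)
  set pB := periodBox (d := d) (m + 1) with hpB
  set N : ℝ := (Fintype.card n : ℝ) with hN
  have hN0 : 0 < N := Nat.cast_pos.mpr Fintype.card_pos
  set ρ : ℝ := Real.pi / 2 * θ with hρ_def
  have hρ0 : 0 ≤ ρ := by positivity
  have h0mem : (0 : Site d) ∈ pB := mem_periodBox.2 fun κ => ⟨le_rfl, by simp⟩
  -- §1 the parameter space and the functional
  let S : Type _ := PiLp 2 (fun _ : ↥pB => HSMat n)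
  let ext : S → Site d → Matrix n n ℂ := fun a x => if h : x ∈ pB then ofHS (a ⟨x, h⟩) else 1
  have hext_cont : ∀ x : Site d, Continuous fun a : S => ext a x := by
    intro x
    by_cases h : x ∈ pB
    · let f : HSMat n →ₗ[ℝ] Matrix n n ℂ := { toFun := ofHS, map_add' := ofHS_add, map_smul' := ofHS_smul }
      have hf : Continuous f := f.continuous_of_finiteDimensional
      have : (fun a : S => ext a x) = fun a : S => f (a ⟨x, h⟩) := by funext a; simp only [ext, dif_pos h]; rfl
      rw [this]
      exact hf.comp (PiLp.continuous_apply 2 _ (⟨x, h⟩ : ↥pB))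
    · have : (fun a : S => ext a x) = fun _ => 1 := by funext a; simp only [ext, dif_neg h]
      rw [this]; exact continuous_const
  let Φ : S → ℝ := fun a =>
    ∑ x ∈ pB, ∑ κ : Fin d, (if x + e κ ∈ pB then (1 - nReTr (ext a x * V x κ * (ext a (x + e κ))ᴴ)) else 0)
  have hΦ : Continuous Φ := by
    refine continuous_finsetSum _ fun x _ => continuous_finsetSum _ fun κ _ => ?_
    split_ifs
    · exact continuous_const.sub (continuous_nReTr.comp (((hext_cont x).mul continuous_const).mul (hext_cont (x + e κ)).matrix_conjTranspose))
    · exact continuous_const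
  -- §2 the constraint set: unitary, `θ`-close to `1`, pinned at `0`
  let K : Set S := {a | (∀ s : ↥pB, ofHS (a s) ∈ unitary (Matrix n n ℂ) ∧ ‖ofHS (a s) - 1‖ ≤ θ) ∧ ofHS (a ⟨0, h0mem⟩) = 1}
  have hev : ∀ s : ↥pB, Continuous fun a : S => ofHS (a s) := by
    intro s
    have h := hext_cont (s : Site d)
    have e1 : (fun a : S => ext a (s : Site d)) = fun a : S => ofHS (a s) := by funext a; simp only [ext, dif_pos s.2]
    rwa [e1] at h
  have hKclosed : IsClosed K := by
    have hK : K = (⋂ s : ↥pB, ({a : S | ofHS (a s) ∈ unitary (Matrix n n ℂ)} ∩ {a : S | ‖ofHS (a s) - 1‖ ≤ θ}))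
        ∩ {a : S | ofHS (a ⟨0, h0mem⟩) = 1} := by
      ext a; simp only [K, Set.mem_setOf_eq, Set.mem_inter_iff, Set.mem_iInter]
    rw [hK]
    refine (isClosed_iInter fun s => (isClosed_unitary.preimage (hev s)).inter ?_).inter ?_
    · exact isClosed_le ((hev s).sub continuous_const).norm continuous_const
    · exact isClosed_eq (hev _) continuous_const
  have hKbdd : Bornology.IsBounded K := by
    rw [isBounded_iff_forall_norm_le]
    refine ⟨Real.sqrt (Fintype.card ↥pB), fun a ha => ?_⟩
    rw [PiLp.norm_eq_of_L2]
    refine Real.sqrt_le_sqrt ?_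
    calc ∑ s : ↥pB, ‖a s‖ ^ 2 ≤ ∑ _s : ↥pB, (1 : ℝ) := Finset.sum_le_sum fun s _ => norm_sq_le_one_of_unitary (ha.1 s).1
      _ = Fintype.card ↥pB := by rw [Finset.sum_const, Finset.card_univ, nsmul_eq_mul, mul_one]
  have hKc : IsCompact K := Metric.isCompact_of_isClosed_isBounded hKclosed hKbdd
  let a₁ : S := (WithLp.equiv 2 _).symm fun _ => toHS (1 : Matrix n n ℂ)
  have ha₁ : ∀ s : ↥pB, ofHS (a₁ s) = 1 := fun s => rfl
  have hK1 : a₁ ∈ K := ⟨fun s => ⟨by rw [ha₁]; exact (unitary (Matrix n n ℂ)).one_mem, by rw [ha₁, sub_self, norm_zero]; exact hθ.le⟩, ha₁ _⟩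
  obtain ⟨a₀, ha₀K, hmin⟩ := hKc.exists_isMinOn ⟨_, hK1⟩ hΦ.continuousOn
  -- §3 the minimising gauge
  set g : Site d → Matrix n n ℂ := ext a₀ with hg_def
  have hg_in : ∀ (x : Site d) (hx : x ∈ pB), g x = ofHS (a₀ ⟨x, hx⟩) := fun x hx => by simp only [hg_def, ext, dif_pos hx]
  have hg_out : ∀ x : Site d, x ∉ pB → g x = 1 := fun x hx => by simp only [hg_def, ext, dif_neg hx]
  have hg_unit : ∀ x, g x ∈ Matrix.unitaryGroup n ℂ := by
    intro x
    by_cases hx : x ∈ pB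
    · rw [hg_in x hx]; exact (ha₀K.1 ⟨x, hx⟩).1
    · rw [hg_out x hx]; exact (unitary (Matrix n n ℂ)).one_mem
  have hg0 : g 0 = 1 := by rw [hg_in 0 h0mem]; exact ha₀K.2
  have hgθ : ∀ x, ‖g x - 1‖ ≤ θ := by
    intro x
    by_cases hx : x ∈ pB
    · rw [hg_in x hx]; exact (ha₀K.1 ⟨x, hx⟩).2
    · rw [hg_out x hx, sub_self, norm_zero]; exact hθ.le
  have hΦg : Φ a₀ = ∑ x ∈ pB, ∑ κ : Fin d, (if x + e κ ∈ pB then (1 - nReTr (g x * V x κ * (g (x + e κ))ᴴ)) else 0) := rfl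
  have hΦ1 : Φ a₁ = ∑ x ∈ pB, ∑ κ : Fin d, (if x + e κ ∈ pB then (1 - nReTr (V x κ)) else 0) := by
    refine Finset.sum_congr rfl fun x _ => Finset.sum_congr rfl fun κ _ => ?_
    have e1 : ∀ z, ext a₁ z = 1 := fun z => by by_cases hz : z ∈ pB <;> simp only [ext, hz, dif_pos, dif_neg, ha₁, not_false_eq_true]
    simp only [e1, one_mul, Matrix.conjTranspose_one, mul_one]
  have hmin1 : Φ a₀ ≤ Φ a₁ := hmin hK1
  -- the gauged links and their Euler–Lagrange expression
  set W : Site d → Fin d → Matrix n n ℂ := fun x κ => g x * V x κ * (g (x + e κ))ᴴ with hW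
  -- §4 the logarithms of the gauge
  have hlog : ∀ x : Site d, ∃ η : Matrix n n ℂ, η ∈ skewAdjoint (Matrix n n ℂ) ∧ exp η = g x ∧ ‖g x - 1‖ ≤ ‖η‖ ∧ ‖η‖ ≤ Real.pi / 2 * ‖g x - 1‖ := by
    intro x
    obtain ⟨A, hA, -, hexp, hlow, hup⟩ := MatrixLog.exists_isHermitian_exp_eq (hg_unit x)
    refine ⟨Complex.I • A, ?_, hexp, ?_, ?_⟩
    · rw [skewAdjoint.mem_iff, star_smul, Complex.star_def, Complex.conj_I, Matrix.star_eq_conjTranspose, hA.eq, neg_smul]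
    · have : ‖Complex.I • A‖ = ‖A‖ := by rw [norm_smul, Complex.norm_I, one_mul]
      rw [this]; exact hlow
    · have : ‖Complex.I • A‖ = ‖A‖ := by rw [norm_smul, Complex.norm_I, one_mul]
      rw [this]; exact hup
  choose η hηskew hηexp hηlow hηup using hlog
  have hηρ : ∀ x, ‖η x‖ ≤ ρ := fun x => (hηup x).trans (by rw [hρ_def]; exact mul_le_mul_of_nonneg_left (hgθ x) (by positivity))
  have hη0 : ∀ x, g x = 1 → η x = 0 := fun x hx => by
    have h := hηup x; rw [hx, sub_self, norm_zero, mul_zero] at h; exact norm_le_zero_iff.1 h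
  have hηout : ∀ x, x ∉ pB → η x = 0 := fun x hx => hη0 x (hg_out x hx)
  have hexpneg : ∀ x, exp (-η x) = (g x)ᴴ := by
    intro x
    have h1 : (η x)ᴴ = -η x := by rw [← Matrix.star_eq_conjTranspose]; exact skewAdjoint.mem_iff.1 (hηskew x)
    rw [← hηexp x, ← Matrix.exp_conjTranspose, h1]
  -- §5 the segment `t ↦ e^{tη}` and its derivatives
  set φ : ℝ → ℝ := fun t => ∑ x ∈ pB, ∑ κ : Fin d, (if x + e κ ∈ pB then
    (1 - nReTr (exp ((t : ℂ) • η x) * V x κ * exp (-((t : ℂ) • η (x + e κ))))) else 0) with hφ_def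
  set φ1 : ℝ → ℝ := fun t => ∑ x ∈ pB, ∑ κ : Fin d, (if x + e κ ∈ pB then
    -nReTr (η x * (exp ((t : ℂ) • η x) * V x κ * exp (-((t : ℂ) • η (x + e κ))))
      - (exp ((t : ℂ) • η x) * V x κ * exp (-((t : ℂ) • η (x + e κ)))) * η (x + e κ)) else 0) with hφ1_def
  set φ2 : ℝ → ℝ := fun t => ∑ x ∈ pB, ∑ κ : Fin d, (if x + e κ ∈ pB then
    -nReTr (η x * (η x * (exp ((t : ℂ) • η x) * V x κ * exp (-((t : ℂ) • η (x + e κ))))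
        - (exp ((t : ℂ) • η x) * V x κ * exp (-((t : ℂ) • η (x + e κ)))) * η (x + e κ))
      - (η x * (exp ((t : ℂ) • η x) * V x κ * exp (-((t : ℂ) • η (x + e κ))))
        - (exp ((t : ℂ) • η x) * V x κ * exp (-((t : ℂ) • η (x + e κ)))) * η (x + e κ)) * η (x + e κ)) else 0) with hφ2_def
  have hφd : ∀ t, HasDerivAt φ (φ1 t) t := fun t =>
    HasDerivAt.fun_sum fun x _ => hasDerivAt_sum_ite _ _ fun κ _ _ => hasDerivAt_one_sub_nReTr_expConj (η x) (η (x + e κ)) (V x κ) t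
  have hφ1d : ∀ t, HasDerivAt φ1 (φ2 t) t := fun t =>
    HasDerivAt.fun_sum fun x _ => hasDerivAt_sum_ite _ _ fun κ _ _ => hasDerivAt_nReTr_firstVar (η x) (η (x + e κ)) (V x κ) t
  have hφ1_eq : φ 1 = Φ a₀ := by
    rw [hΦg]
    refine Finset.sum_congr rfl fun x _ => Finset.sum_congr rfl fun κ _ => ?_
    simp only [Complex.ofReal_one, one_smul, hηexp, hexpneg]
  have hφ0_eq : φ 0 = Φ a₁ := by
    rw [hΦ1]
    refine Finset.sum_congr rfl fun x _ => Finset.sum_congr rfl fun κ _ => ?_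
    simp only [Complex.ofReal_zero, zero_smul, neg_zero, exp_zero, one_mul, mul_one]
  have hφ10 : φ 1 ≤ φ 0 := by rw [hφ1_eq, hφ0_eq]; exact hmin1
  -- the first variation at `t = 0`
  have hφ1_0 : |φ1 0| ≤ (1 / 2) * (((m + 1 : ℕ) : ℝ) ^ d * (ρ * e₀)) := by
    have h := segment_firstVar_abs_le m V hρ0 hEL η (fun x _ => hηskew x) (fun x _ => hηρ x)
    have e1 : φ1 0 = -∑ x ∈ pB, ∑ κ : Fin d, (if x + e κ ∈ pB then nReTr (η x * V x κ - V x κ * η (x + e κ)) else 0) := by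
      rw [hφ1_def]
      simp only [Complex.ofReal_zero, zero_smul, neg_zero, exp_zero, one_mul, mul_one]
      rw [← Finset.sum_neg_distrib]
      refine Finset.sum_congr rfl fun x _ => ?_
      rw [← Finset.sum_neg_distrib]
      refine Finset.sum_congr rfl fun κ _ => ?_
      split_ifs <;> simp
    rw [e1, abs_neg]; exact h
  -- the second variation along the segment
  set Dη : ℝ := ∑ x ∈ pB, ∑ κ : Fin d, (if x + e κ ∈ pB then nhsNormSq (η (x + e κ) - η x) else 0) with hDη
  have hDη0 : 0 ≤ Dη := Finset.sum_nonneg fun x _ => Finset.sum_nonneg fun κ _ => by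
    split_ifs
    · exact MatrixNorms.nhsNormSq_nonneg _
    · exact le_rfl
  set e₁ : ℝ := e₀ + 4 * d * ((1 + v₀) * (Real.exp (2 * ρ) - 1)) with he₁
  have hφ2_low : ∀ t ∈ Icc (0 : ℝ) 1, (1 / 2) * Dη - ρ ^ 2 * ((m + 1 : ℕ) : ℝ) ^ d * e₁ ≤ φ2 t := by
    intro t ht
    have h := segment_secondVar_lower hd m V hv₀ hρ0 hV1 hEL η (fun x _ => hηskew x) (fun x _ => hηρ x) hηout ht
    have hcoef : 1 / 2 ≤ (1 - N * (Real.exp (2 * ρ) * (1 + v₀) - 1) - 2 * N * d * (m + 1) * (Real.exp (2 * ρ) * (1 + v₀) - 1)) := by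
      rw [hρ_def]; linarith
    have h2 : (1 / 2) * Dη ≤ (1 - N * (Real.exp (2 * ρ) * (1 + v₀) - 1) - 2 * N * d * (m + 1) * (Real.exp (2 * ρ) * (1 + v₀) - 1)) * Dη :=
      mul_le_mul_of_nonneg_right hcoef hDη0
    rw [he₁]; linarith
  -- §6 the minimiser is interior
  have hinterior : ∀ x ∈ pB, ‖g x - 1‖ < θ := by
    by_contra hcon
    simp only [not_forall, not_lt, exists_prop] at hcon
    obtain ⟨x₁, hx₁, hx₁θ⟩ := hcon
    have hx₁eq : ‖g x₁ - 1‖ = θ := le_antisymm (hgθ x₁) hx₁θ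
    -- `‖η x₁‖ ≥ θ`, `η 0 = 0`, and the path bound give `D(η) ≥ θ²∕(N d² m²)`
    have hη1 : θ ≤ ‖η x₁‖ := hx₁eq ▸ hηlow x₁
    have hη00 : η 0 = 0 := hη0 0 hg0
    have hδ : ∀ (z : Site d) (κ : Fin d), z ∈ pB → z + e κ ∈ pB → ‖η (z + e κ) - η z‖ ≤ Real.sqrt (N * Dη) := by
      intro z κ hz hzκ
      have h1 : ‖η (z + e κ) - η z‖ ^ 2 ≤ N * nhsNormSq (η (z + e κ) - η z) := norm_sq_le_card_mul_nhsNormSq _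
      have h2 : nhsNormSq (η (z + e κ) - η z) ≤ Dη := by
        rw [hDη]
        have h3 : (if z + e κ ∈ pB then nhsNormSq (η (z + e κ) - η z) else 0) ≤ ∑ κ' : Fin d,
            (if z + e κ' ∈ pB then nhsNormSq (η (z + e κ') - η z) else 0) :=
          Finset.single_le_sum (f := fun κ' => (if z + e κ' ∈ pB then nhsNormSq (η (z + e κ') - η z) else 0))
            (fun κ' _ => by split_ifs <;> first | exact MatrixNorms.nhsNormSq_nonneg _ | exact le_rfl) (Finset.mem_univ κ)
        have h4 : ∑ κ' : Fin d, (if z + e κ' ∈ pB then nhsNormSq (η (z + e κ') - η z) else 0)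
            ≤ ∑ x ∈ pB, ∑ κ' : Fin d, (if x + e κ' ∈ pB then nhsNormSq (η (x + e κ') - η x) else 0) :=
          Finset.single_le_sum (f := fun x => ∑ κ' : Fin d, (if x + e κ' ∈ pB then nhsNormSq (η (x + e κ') - η x) else 0))
            (fun x _ => Finset.sum_nonneg fun κ' _ => by split_ifs <;> first | exact MatrixNorms.nhsNormSq_nonneg _ | exact le_rfl) hz
        rw [if_pos hzκ] at h3
        exact h3.trans h4
      refine Real.le_sqrt_of_sq_le ?_
      exact h1.trans (mul_le_mul_of_nonneg_left h2 hN0.le)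
    have hsumx₁ : (∑ i, x₁ i) = ((∑ i, (x₁ i).toNat : ℕ) : ℤ) := by
      push_cast
      refine Finset.sum_congr rfl fun i _ => ?_
      rw [Int.toNat_of_nonneg ((mem_periodBox.1 hx₁) i).1]
    have hpath := norm_sub_zero_le_path (M := m + 1) η hδ (∑ i, (x₁ i).toNat) x₁ hx₁ hsumx₁
    rw [hη00, sub_zero] at hpath
    have hcoord : ((∑ i, (x₁ i).toNat : ℕ) : ℝ) ≤ d * m := by
      have h1 : ∀ i, (x₁ i).toNat ≤ m := fun i => by
        have h := (mem_periodBox.1 hx₁) i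
        have : (x₁ i).toNat < m + 1 := by zify; rw [Int.toNat_of_nonneg h.1]; exact_mod_cast h.2
        omega
      calc ((∑ i, (x₁ i).toNat : ℕ) : ℝ) ≤ ((∑ _i : Fin d, m : ℕ) : ℝ) := by exact_mod_cast Finset.sum_le_sum fun i _ => h1 i
        _ = d * m := by rw [Finset.sum_const, Finset.card_univ, Fintype.card_fin, smul_eq_mul]; push_cast; ring
    have hθ_le : θ ≤ d * m * Real.sqrt (N * Dη) := by
      calc θ ≤ ‖η x₁‖ := hη1
        _ ≤ ((∑ i, (x₁ i).toNat : ℕ) : ℝ) * Real.sqrt (N * Dη) := hpath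
        _ ≤ d * m * Real.sqrt (N * Dη) := mul_le_mul_of_nonneg_right hcoord (Real.sqrt_nonneg _)
    have hDlow : θ ^ 2 ≤ (d * m) ^ 2 * (N * Dη) := by
      have h1 : θ ^ 2 ≤ (d * m * Real.sqrt (N * Dη)) ^ 2 := pow_le_pow_left₀ hθ.le hθ_le 2
      rw [mul_pow, Real.sq_sqrt (mul_nonneg hN0.le hDη0)] at h1
      exact h1
    -- Taylor on `[0,1]` contradicts minimality
    have hm0 : (0 : ℝ) < m := by exact_mod_cast hm
    have hd0 : (0 : ℝ) < d := by exact_mod_cast hd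
    have hT := taylor_lower_unit_interval hφd hφ1d hφ2_low
    have hDη_low : θ ^ 2 / (N * d ^ 2 * m ^ 2) ≤ Dη := by
      rw [div_le_iff₀ (by positivity)]
      calc θ ^ 2 ≤ (d * m) ^ 2 * (N * Dη) := hDlow
        _ = Dη * (N * d ^ 2 * m ^ 2) := by ring
    have hsmall' : (1 / 2) * (((m + 1 : ℕ) : ℝ) ^ d * (ρ * e₀)) + (1 / 2) * (ρ ^ 2 * ((m + 1 : ℕ) : ℝ) ^ d * e₁)
        < θ ^ 2 / (4 * N * d ^ 2 * m ^ 2) := by rw [hρ_def, he₁]; exact hsmall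
    have hquarter : θ ^ 2 / (4 * N * d ^ 2 * m ^ 2) = (1 / 4) * (θ ^ 2 / (N * d ^ 2 * m ^ 2)) := by
      field_simp
    have h1 := (abs_le.1 hφ1_0).1
    nlinarith [hT, hφ10, h1, hDη_low, hsmall', hquarter]
  -- §7 the Euler–Lagrange equation at every site `y ≠ 0` by single-site variations
  have hELy : ∀ y ∈ pB, y ≠ 0 → (∑ κ : Fin d, ((if y + e κ ∈ pB then W y κ else 0) - (if y - e κ ∈ pB then W (y - e κ) κ else 0)))
      - (∑ κ : Fin d, ((if y + e κ ∈ pB then W y κ else 0) - (if y - e κ ∈ pB then W (y - e κ) κ else 0)))ᴴ = 0 := by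
    intro y hy hy0
    refine EL_of_critical fun Z hZ => ?_
    -- the perturbed gauges
    let at_ : ℝ → S := fun t => (WithLp.equiv 2 _).symm fun s => toHS ((if (s : Site d) = y then exp ((t : ℂ) • Z) else 1) * g s)
    have hat_apply : ∀ (t : ℝ) (s : ↥pB), ofHS (at_ t s) = (if (s : Site d) = y then exp ((t : ℂ) • Z) else 1) * g s := fun t s => rfl
    have hext_at : ∀ (t : ℝ) (x : Site d), ext (at_ t) x = (if x = y then exp ((t : ℂ) • Z) else 1) * g x := by
      intro t x
      by_cases hx : x ∈ pB
      · simp only [ext, dif_pos hx, hat_apply]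
      · have hxy : x ≠ y := fun h => hx (h ▸ hy)
        simp only [ext, dif_neg hx, if_neg hxy, one_mul, hg_out x hx]
    have htZ : ∀ t : ℝ, (t : ℂ) • Z ∈ skewAdjoint (Matrix n n ℂ) := fun t => by
      have h := skewAdjoint.smul_mem (t : ℝ) hZ
      rwa [← Complex.coe_smul] at h
    have hexpu : ∀ t : ℝ, exp ((t : ℂ) • Z) ∈ unitary (Matrix n n ℂ) := fun t => NormedSpace.exp_mem_unitary_of_mem_skewAdjoint (htZ t)
    -- `at_ t ∈ K` for `t` near `0`
    have hnear : ∀ᶠ t in nhds (0 : ℝ), at_ t ∈ K := by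
      have hcont : Continuous fun t : ℝ => ‖exp ((t : ℂ) • Z) * g y - 1‖ := by
        refine ((Continuous.mul ?_ continuous_const).sub continuous_const).norm
        exact NormedSpace.exp_continuous.comp (Complex.continuous_ofReal.smul continuous_const)
      have hlt : ‖exp (((0 : ℝ) : ℂ) • Z) * g y - 1‖ < θ := by
        simp only [Complex.ofReal_zero, zero_smul, exp_zero, one_mul]; exact hinterior y hy
      have hev := hcont.continuousAt.eventually_lt continuousAt_const hlt
      filter_upwards [hev] with t ht
      refine ⟨fun s => ⟨?_, ?_⟩, ?_⟩
      · rw [hat_apply]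
        by_cases hs : (s : Site d) = y
        · rw [if_pos hs]; exact (unitary (Matrix n n ℂ)).mul_mem (hexpu t) (hg_unit s)
        · rw [if_neg hs, one_mul]; exact hg_unit s
      · rw [hat_apply]
        by_cases hs : (s : Site d) = y
        · rw [if_pos hs, hs]; exact ht.le
        · rw [if_neg hs, one_mul]; exact hgθ s
      · rw [hat_apply]; simp only [if_neg (Ne.symm hy0), one_mul]; exact hg0
    -- the functional along the perturbation is the site variation of `W`
    have hlink : ∀ (t : ℝ) (x : Site d) (κ : Fin d), ext (at_ t) x * V x κ * (ext (at_ t) (x + e κ))ᴴ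
        = (if x = y then exp ((t : ℂ) • Z) else 1) * W x κ * (if x + e κ = y then exp (-((t : ℂ) • Z)) else 1) := by
      intro t x κ
      have hstar : ((if x + e κ = y then exp ((t : ℂ) • Z) else (1 : Matrix n n ℂ)))ᴴ = (if x + e κ = y then exp (-((t : ℂ) • Z)) else 1) := by
        split_ifs
        · have h2 : ((t : ℂ) • Z)ᴴ = -((t : ℂ) • Z) := by
            rw [← Matrix.star_eq_conjTranspose]; exact skewAdjoint.mem_iff.1 (htZ t)
          rw [← Matrix.exp_conjTranspose, h2]
        · exact Matrix.conjTranspose_one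
      rw [hext_at, hext_at, Matrix.conjTranspose_mul, hstar, hW]
      simp only [mul_assoc]
    have hΦat : ∀ t : ℝ, Φ (at_ t) = ∑ x ∈ pB, ∑ κ : Fin d, (if x + e κ ∈ pB then
        (1 - nReTr ((if x = y then exp ((t : ℂ) • Z) else 1) * W x κ * (if x + e κ = y then exp (-((t : ℂ) • Z)) else 1))) else 0) := by
      intro t
      refine Finset.sum_congr rfl fun x _ => Finset.sum_congr rfl fun κ _ => ?_
      rw [hlink]
    have hloc : IsLocalMin (fun t : ℝ => Φ (at_ t)) 0 := by
      filter_upwards [hnear] with t ht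
      have h0 : Φ (at_ 0) = Φ a₀ := by
        rw [hΦat, hΦg]
        refine Finset.sum_congr rfl fun x _ => Finset.sum_congr rfl fun κ _ => ?_
        simp only [Complex.ofReal_zero, zero_smul, neg_zero, exp_zero, ite_self, one_mul, mul_one, hW]
      rw [h0]; exact hmin ht
    have hder := hasDerivAt_siteVariation (m + 1) W hy Z
    have hder' : HasDerivAt (fun t : ℝ => Φ (at_ t)) (-nReTr (Z * ∑ κ : Fin d, ((if y + e κ ∈ pB then W y κ else 0)
        - (if y - e κ ∈ pB then W (y - e κ) κ else 0)))) 0 := by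
      have e1 : (fun t : ℝ => Φ (at_ t)) = fun t : ℝ => ∑ x ∈ pB, ∑ κ : Fin d, (if x + e κ ∈ pB then
          (1 - nReTr ((if x = y then exp ((t : ℂ) • Z) else 1) * W x κ * (if x + e κ = y then exp (-((t : ℂ) • Z)) else 1))) else 0) := by
        funext t; exact hΦat t
      rw [e1]; exact hder
    have hzero := hloc.hasDerivAt_eq_zero hder'
    rw [neg_eq_zero] at hzero
    exact hzero
  -- §8 conclusion: the Euler–Lagrange expression of `W` in the stated form
  have hELW : ∀ y ∈ pB, ∑ κ : Fin d, ((if y + e κ ∈ pB then (W y κ - (W y κ)ᴴ) else 0)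
      - (if y - e κ ∈ pB then (W (y - e κ) κ - (W (y - e κ) κ)ᴴ) else 0)) = 0 := by
    -- the odd part of `D_W` is `E_W`
    have hodd : ∀ y : Site d, (∑ κ : Fin d, ((if y + e κ ∈ pB then W y κ else 0) - (if y - e κ ∈ pB then W (y - e κ) κ else 0)))
        - (∑ κ : Fin d, ((if y + e κ ∈ pB then W y κ else 0) - (if y - e κ ∈ pB then W (y - e κ) κ else 0)))ᴴ
        = ∑ κ : Fin d, ((if y + e κ ∈ pB then (W y κ - (W y κ)ᴴ) else 0) - (if y - e κ ∈ pB then (W (y - e κ) κ - (W (y - e κ) κ)ᴴ) else 0)) := by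
      intro y
      rw [Matrix.conjTranspose_sum, ← Finset.sum_sub_distrib]
      refine Finset.sum_congr rfl fun κ _ => ?_
      by_cases hp : y + e κ ∈ pB <;> by_cases hq : y - e κ ∈ pB <;>
        simp only [hp, hq, if_true, if_false, Matrix.conjTranspose_sub, Matrix.conjTranspose_zero, sub_zero, zero_sub, neg_sub,
          Matrix.conjTranspose_neg] <;> abel
    have hne : ∀ y ∈ pB, y ≠ 0 → ∑ κ : Fin d, ((if y + e κ ∈ pB then (W y κ - (W y κ)ᴴ) else 0)
        - (if y - e κ ∈ pB then (W (y - e κ) κ - (W (y - e κ) κ)ᴴ) else 0)) = 0 := fun y hy hy0 => by rw [← hodd y]; exact hELy y hy hy0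
    intro y hy
    by_cases hy0 : y = 0
    · subst hy0
      have htot := sum_EL_eq_zero (m + 1) (fun x κ => W x κ - (W x κ)ᴴ)
      rw [← Finset.add_sum_erase _ _ h0mem] at htot
      have hrest : ∑ x ∈ pB.erase 0, ∑ κ : Fin d, ((if x + e κ ∈ pB then (W x κ - (W x κ)ᴴ) else 0)
          - (if x - e κ ∈ pB then (W (x - e κ) κ - (W (x - e κ) κ)ᴴ) else 0)) = 0 :=
        Finset.sum_eq_zero fun x hx => hne x (Finset.mem_of_mem_erase hx) (Finset.ne_of_mem_erase hx)
      rw [hrest, add_zero] at htot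
      exact htot
    · exact hne y hy hy0
  refine ⟨g, hg_unit, hg_out, hg0, hgθ, fun y hy => ?_⟩
  have h := hELW y hy
  simp only [hW] at h
  exact h

end

end Summit.QuantumFields.BalabanUV.T4Continuum.NE7FreeLandauStep
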